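import Literature.Geometry.ComplexHyperbolic.UnitBallBounds
import HarnessLib

/-!
# The `J`-orthogonal projector onto a negative line of `ℂ^{2,1}` (ROAD A (A3-b), algebraic half)

For `w ∈ ℂ³` put `N(w) := w w* J` and, when `Q(w) ≠ 0`, `P(w) := Q(w)⁻¹ · N(w)` (spelled out, no new definitions):
the `J`-orthogonal projector onto the line `ℂw`.  This module records the algebra used by the `K`-central orbital integrals
of `U(2,1)` (★ `UnitBallKCentralOrbitalIntegral`: `g·diag(u,u,v)·g⁻¹ = u•1 + (v−u)•P(g·lift x₀)`) and by their `v → u`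
asymptotics against the Bergman volume `(1−|z|²)⁻³dz`:

* §1 `N(w)² = Q(w)•N(w)`, `trace N(w) = Q(w)`, `N(w)w = Q(w)w`, `J N(w)ᴴ J = N(w)`; hence for `Q(w) ≠ 0`: **`P(w)² = P(w)`, `trace P(w) = 1`,
  `P(w)w = w`, `J P(w)ᴴ J = P(w)`** — a `J`-selfadjoint rank-one idempotent; and on the light cone `Q(w) = 0`: `N(w)² = 0`, `trace N(w) = 0`
  (the asymptotic cone of the orbit `Ad(U(2,1))E₃₃` consists of square-zero matrices).
* §2 along the ball (`w = lift z = (z₀, z₁, 1)`, `Q(lift z) = |z|² − 1`, ★ `Q_lift`): the BLOW-UP NORMALISATION **`(1 − |z|²)•P(lift z) = −N(lift z)`** with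
  `‖N(lift z)ᵢⱼ‖ ≤ 1`, hence **`‖P(lift z)ᵢⱼ‖ ≤ (1 − |z|²)⁻¹`**, and `ε•P(lift z) = −(ε ∕ (1−|z|²))•N(lift z)`; continuity of `N` on `ℂ³`
  and the boundary values `Q(ω₀, ω₁, 1) = 0` for `|ω|² = 1`.

References: Rogawski 1990 §8.4 (the singular orbital integrals at the compact wall); Jacobowitz 1990, Ch. 2 §1 (the form `Q`, negative lines
and the ball); Goldman 1999, §3.1 (projective model of `H²_ℂ`, orthogonal projection onto a negative line); Rudin 1980, §1.4, §2.2 (automorphisms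
of the ball, the invariant measure `(1−|z|²)⁻³dν`).
HONEST LABEL: HC_CM is proved only modulo the printed citations until rung 0 closes; this file is matrix algebra over ★ `UnitBallU21`∕`UnitBallBounds`
and pays nothing by itself.
-/

noncomputable section

open Matrix Complex ComplexConjugate

namespace Literature.Geometry.ComplexHyperbolic.BallModel

/-! ### §1 The matrix `N(w) = w w* J` and the projector `P(w) = Q(w)⁻¹ N(w)` -/

/-- `(w* J) · w = Q(w)`: the row vector `w*J` paired with `w`. [cite: Jacobowitz1990, Ch. 2 §1] -/
theorem star_vecMul_J_dotProduct_self (w : Fin 3 → ℂ) : (star w ᵥ* J) ⬝ᵥ w = ((Q w : ℝ) : ℂ) := by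
  rw [← dotProduct_mulVec, form_eq_Q]

/-- **`N(w)² = Q(w)•N(w)`** for `N(w) = w w* J`. [cite: Goldman1999, §3.1.1] -/
theorem vecMulVec_star_mul_J_mul_self (w : Fin 3 → ℂ) :
    (vecMulVec w (star w) * J) * (vecMulVec w (star w) * J) = ((Q w : ℝ) : ℂ) • (vecMulVec w (star w) * J) := by
  rw [vecMulVec_mul, vecMulVec_mul_vecMulVec, star_vecMul_J_dotProduct_self, vecMulVec_smul]

/-- **`trace N(w) = Q(w)`**. [cite: Goldman1999, §3.1.1] -/
theorem trace_vecMulVec_star_mul_J (w : Fin 3 → ℂ) : trace (vecMulVec w (star w) * J) = ((Q w : ℝ) : ℂ) := by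
  rw [vecMulVec_mul, trace_vecMulVec, dotProduct_comm, star_vecMul_J_dotProduct_self]

/-- **`N(w) w = Q(w) w`**. [cite: Goldman1999, §3.1.1] -/
theorem vecMulVec_star_mul_J_mulVec_self (w : Fin 3 → ℂ) : (vecMulVec w (star w) * J) *ᵥ w = ((Q w : ℝ) : ℂ) • w := by
  rw [← mulVec_mulVec, vecMulVec_mulVec, form_eq_Q, IsCentralScalar.op_smul_eq_smul]

/-- **`N(w)` IS `J`-SELFADJOINT**: `N(w)ᴴ = J N(w) J`, i.e. `J N(w)ᴴ J = N(w)`. [cite: Goldman1999, §3.1.1] -/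
theorem J_mul_conjTranspose_vecMulVec_star_mul_J_mul_J (w : Fin 3 → ℂ) :
    J * (vecMulVec w (star w) * J)ᴴ * J = vecMulVec w (star w) * J := by
  -- `Jᴴ = J` (★ `BallForms.conjTranspose_J`, inlined to keep this module import-light)
  have hJ : Jᴴ = J := by
    rw [J, diagonal_conjTranspose]
    congr 1
    funext i
    fin_cases i <;> simp
  rw [conjTranspose_mul, conjTranspose_vecMulVec, star_star, hJ, ← Matrix.mul_assoc, J_mul_J, Matrix.one_mul]

/-- On the light cone `Q(w) = 0` the matrix `N(w)` has square zero (the asymptotic cone of `Ad(U(2,1))E₃₃` is made of square-zero rank-one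
matrices). [cite: Goldman1999, §3.1.1] -/
theorem vecMulVec_star_mul_J_mul_self_of_Q_eq_zero {w : Fin 3 → ℂ} (hw : Q w = 0) :
    (vecMulVec w (star w) * J) * (vecMulVec w (star w) * J) = 0 := by
  rw [vecMulVec_star_mul_J_mul_self, hw, Complex.ofReal_zero, zero_smul]

/-- … and trace zero. [cite: Goldman1999, §3.1.1] -/
theorem trace_vecMulVec_star_mul_J_of_Q_eq_zero {w : Fin 3 → ℂ} (hw : Q w = 0) : trace (vecMulVec w (star w) * J) = 0 := by
  rw [trace_vecMulVec_star_mul_J, hw, Complex.ofReal_zero]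

/-- **`P(w)` IS IDEMPOTENT**: `P(w)² = P(w)` for `P(w) = Q(w)⁻¹•N(w)`, `Q(w) ≠ 0`. [cite: Goldman1999, §3.1.1] [cite: Jacobowitz1990, Ch. 2 §1] -/
theorem pencil_mul_pencil {w : Fin 3 → ℂ} (hw : Q w ≠ 0) :
    ((((Q w : ℝ) : ℂ))⁻¹ • (vecMulVec w (star w) * J)) * ((((Q w : ℝ) : ℂ))⁻¹ • (vecMulVec w (star w) * J)) =
      (((Q w : ℝ) : ℂ))⁻¹ • (vecMulVec w (star w) * J) := by
  have hQ : ((Q w : ℝ) : ℂ) ≠ 0 := by exact_mod_cast hw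
  rw [Matrix.smul_mul, Matrix.mul_smul, vecMulVec_star_mul_J_mul_self, smul_smul, smul_smul, inv_mul_cancel_right₀ hQ]

/-- **`trace P(w) = 1`** (`Q(w) ≠ 0`): the projector has rank one. [cite: Goldman1999, §3.1.1] -/
theorem trace_pencil {w : Fin 3 → ℂ} (hw : Q w ≠ 0) : trace ((((Q w : ℝ) : ℂ))⁻¹ • (vecMulVec w (star w) * J)) = 1 := by
  have hQ : ((Q w : ℝ) : ℂ) ≠ 0 := by exact_mod_cast hw
  rw [trace_smul, trace_vecMulVec_star_mul_J, smul_eq_mul, inv_mul_cancel₀ hQ]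

/-- **`P(w) w = w`** (`Q(w) ≠ 0`): `P(w)` projects onto the line `ℂw`. [cite: Goldman1999, §3.1.1] -/
theorem pencil_mulVec_self {w : Fin 3 → ℂ} (hw : Q w ≠ 0) : ((((Q w : ℝ) : ℂ))⁻¹ • (vecMulVec w (star w) * J)) *ᵥ w = w := by
  have hQ : ((Q w : ℝ) : ℂ) ≠ 0 := by exact_mod_cast hw
  rw [smul_mulVec, vecMulVec_star_mul_J_mulVec_self, smul_smul, inv_mul_cancel₀ hQ, one_smul]

/-- **`P(w)` IS `J`-SELFADJOINT**: `J P(w)ᴴ J = P(w)` (`Q(w)` is real). [cite: Goldman1999, §3.1.1] -/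
theorem J_mul_conjTranspose_pencil_mul_J (w : Fin 3 → ℂ) :
    J * ((((Q w : ℝ) : ℂ))⁻¹ • (vecMulVec w (star w) * J))ᴴ * J = (((Q w : ℝ) : ℂ))⁻¹ • (vecMulVec w (star w) * J) := by
  rw [conjTranspose_smul, star_inv₀, Complex.star_def, Complex.conj_ofReal, Matrix.mul_smul, Matrix.smul_mul,
    J_mul_conjTranspose_vecMulVec_star_mul_J_mul_J]

/-- `P(w)` vanishes on the `J`-orthogonal complement: `P(w) y = 0` whenever `w* J y = 0`. [cite: Goldman1999, §3.1.1] -/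
theorem pencil_mulVec_eq_zero_of_orthogonal (w : Fin 3 → ℂ) {y : Fin 3 → ℂ} (hy : star w ⬝ᵥ (J *ᵥ y) = 0) :
    ((((Q w : ℝ) : ℂ))⁻¹ • (vecMulVec w (star w) * J)) *ᵥ y = 0 := by
  rw [smul_mulVec, ← mulVec_mulVec, vecMulVec_mulVec, hy, MulOpposite.op_zero, zero_smul, smul_zero]

/-- `w ↦ N(w) = w w* J` is continuous on `ℂ³`. [cite: Jacobowitz1990, Ch. 2 §1] -/
theorem continuous_vecMulVec_star_mul_J : Continuous fun w : Fin 3 → ℂ => vecMulVec w (star w) * J :=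
  (continuous_id.matrix_vecMulVec continuous_id.star).mul continuous_const

/-! ### §2 Along the ball: blow-up normalisation and entry bounds -/

/-- `Q(lift z) = −(1 − |z|²)` as complex scalars (★ `BallForms.Q_lift_eq` ∕ ★ `Q_lift`, in the cast shape used below). [cite: Jacobowitz1990, Ch. 2 §1] -/
theorem ofReal_Q_lift_eq_neg (z : Ball) : ((Q (lift z) : ℝ) : ℂ) = -(((1 - nsq z.1 : ℝ) : ℂ)) := by
  have h : Q (lift z) = nsq z.1 - 1 := by simp only [Q, lift_0, lift_1, lift_2, norm_one, one_pow, nsq]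
  rw [h]; push_cast; ring

/-- **BLOW-UP NORMALISATION**: `(1 − |z|²)•P(lift z) = −N(lift z)`. [cite: Goldman1999, §3.1.1] [cite: Rudin1980, §2.2] -/
theorem one_sub_nsq_smul_pencil_lift (z : Ball) :
    (((1 - nsq z.1 : ℝ) : ℂ)) • ((((Q (lift z) : ℝ) : ℂ))⁻¹ • (vecMulVec (lift z) (star (lift z)) * J)) =
      -(vecMulVec (lift z) (star (lift z)) * J) := by
  have hQ : ((Q (lift z) : ℝ) : ℂ) ≠ 0 := by exact_mod_cast (Q_lift z).ne
  have h1 : (((1 - nsq z.1 : ℝ) : ℂ)) = -((Q (lift z) : ℝ) : ℂ) := by rw [ofReal_Q_lift_eq_neg, neg_neg]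
  rw [h1, smul_smul, neg_mul, mul_inv_cancel₀ hQ, neg_smul, one_smul]

/-- `ε•P(lift z) = −(ε ∕ (1−|z|²))•N(lift z)`: the pencil parameter against the blow-up coordinate `s = ε∕(1−|z|²)`.
[cite: Goldman1999, §3.1.1] [cite: Rudin1980, §2.2] -/
theorem smul_pencil_lift_eq (ε : ℂ) (z : Ball) :
    ε • ((((Q (lift z) : ℝ) : ℂ))⁻¹ • (vecMulVec (lift z) (star (lift z)) * J)) =
      -((ε / (((1 - nsq z.1 : ℝ) : ℂ))) • (vecMulVec (lift z) (star (lift z)) * J)) := by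
  rw [smul_smul, ofReal_Q_lift_eq_neg, inv_neg, mul_neg, neg_smul, div_eq_mul_inv]

/-- The coordinates of `lift z` have norm `≤ 1` on the ball. [cite: Rudin1980, §1.4] -/
theorem norm_lift_apply_le_one (z : Ball) (i : Fin 3) : ‖lift z i‖ ≤ 1 := by
  have hz := z.2
  have h0 : ‖z.1 0‖ ^ 2 ≤ 1 := by unfold nsq at hz; nlinarith [sq_nonneg ‖z.1 1‖]
  have h1 : ‖z.1 1‖ ^ 2 ≤ 1 := by unfold nsq at hz; nlinarith [sq_nonneg ‖z.1 0‖]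
  fin_cases i
  · simpa using (sq_le_one_iff₀ (norm_nonneg _)).1 h0
  · simpa using (sq_le_one_iff₀ (norm_nonneg _)).1 h1
  · simp

/-- The entries of `N(w) = w w* J`: `N(w)ᵢⱼ = wᵢ · conj wⱼ · Jⱼⱼ`. [cite: Jacobowitz1990, Ch. 2 §1] -/
theorem vecMulVec_star_mul_J_apply (w : Fin 3 → ℂ) (i j : Fin 3) : (vecMulVec w (star w) * J) i j = w i * conj (w j) * J j j := by
  rw [J, mul_diagonal, vecMulVec_apply, Pi.star_apply, Complex.star_def, diagonal_apply_eq]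

/-- **`‖N(lift z)ᵢⱼ‖ ≤ 1`** on the ball. [cite: Rudin1980, §1.4] -/
theorem norm_vecMulVec_lift_mul_J_apply_le_one (z : Ball) (i j : Fin 3) : ‖(vecMulVec (lift z) (star (lift z)) * J) i j‖ ≤ 1 := by
  rw [vecMulVec_star_mul_J_apply, norm_mul, norm_mul, norm_J_apply_self, mul_one, Complex.norm_conj]
  exact mul_le_one₀ (norm_lift_apply_le_one z i) (norm_nonneg _) (norm_lift_apply_le_one z j)

/-- **`‖P(lift z)ᵢⱼ‖ ≤ (1 − |z|²)⁻¹`**: the pencil blows up at most like the inverse distance to the boundary sphere (this is the `‖P_ℓ‖ ≍ (1−|z|²)⁻¹`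
that makes `ε²` the normaliser of the `K`-central orbital integrals). [cite: Rogawski1990, §8.4 pp. 126–127] [cite: Rudin1980, §2.2] -/
theorem norm_pencil_lift_apply_le (z : Ball) (i j : Fin 3) :
    ‖((((Q (lift z) : ℝ) : ℂ))⁻¹ • (vecMulVec (lift z) (star (lift z)) * J)) i j‖ ≤ (1 - nsq z.1)⁻¹ := by
  have hpos : 0 < 1 - nsq z.1 := by have := z.2; linarith
  have hQ : ‖(((Q (lift z) : ℝ) : ℂ))⁻¹‖ = (1 - nsq z.1)⁻¹ := by
    rw [norm_inv, ofReal_Q_lift_eq_neg, norm_neg, Complex.norm_real, Real.norm_eq_abs, abs_of_pos hpos]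
  rw [Matrix.smul_apply, smul_eq_mul, norm_mul, hQ]
  exact mul_le_of_le_one_right (inv_nonneg.2 hpos.le) (norm_vecMulVec_lift_mul_J_apply_le_one z i j)

/-- The `(2,2)` entry: `N(lift z)₂₂ = −1`, so `P(lift z)₂₂ = (1 − |z|²)⁻¹` exactly — the bound above is attained. [cite: Rudin1980, §2.2] -/
theorem pencil_lift_apply_two_two (z : Ball) :
    ((((Q (lift z) : ℝ) : ℂ))⁻¹ • (vecMulVec (lift z) (star (lift z)) * J)) 2 2 = ((((1 - nsq z.1 : ℝ))⁻¹ : ℝ) : ℂ) := by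
  rw [Matrix.smul_apply, smul_eq_mul, vecMulVec_star_mul_J_apply, lift_2, map_one, ofReal_Q_lift_eq_neg]
  simp only [J, diagonal_apply_eq, cons_val, mul_neg, mul_one, inv_neg, neg_neg]
  push_cast
  ring

/-- Boundary values: for `|ω|² = 1` the vector `(ω₀, ω₁, 1)` is `J`-isotropic, `Q = 0` (the boundary sphere of the ball is the light cone
seen in the chart `w₂ = 1`). [cite: Goldman1999, §3.1.1] -/
theorem Q_vecCons_eq_zero_of_nsq_eq_one {ω : Fin 2 → ℂ} (hω : nsq ω = 1) : Q ![ω 0, ω 1, 1] = 0 := by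
  unfold nsq at hω
  simp only [Q, cons_val_zero, cons_val_one, cons_val, norm_one, one_pow]
  linarith

/-- `z ↦ N(lift z)` is continuous on the ball. [cite: Jacobowitz1990, Ch. 2 §1] -/
theorem continuous_vecMulVec_lift_mul_J : Continuous fun z : Ball => vecMulVec (lift z) (star (lift z)) * J := by
  have h0 : Continuous fun z : Ball => z.1 0 := (continuous_apply 0).comp continuous_subtype_val
  have h1 : Continuous fun z : Ball => z.1 1 := (continuous_apply 1).comp continuous_subtype_val
  have hlift : Continuous fun z : Ball => lift z := by
    unfold lift
    exact h0.matrixVecCons (h1.matrixVecCons continuous_const)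
  exact continuous_vecMulVec_star_mul_J.comp hlift

end Literature.Geometry.ComplexHyperbolic.BallModel

end
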